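import Mathlib
import Summits.ResolutionOfSingularities.ResolutionOfSingularities.Theorems.ShadowsUniformize.Negative.IdentityShadow
import Summits.ResolutionOfSingularities.ResolutionOfSingularities.Theorems.SemivaluationShadows.Negative.FalseWithoutRational
import HarnessLib

/-!
# The rank-one arc transfer (`stub_arcShadow`; crux `SemivaluationShadows`, line `birth`)

Stub `stub_arcShadow` of the skeleton `Cruxes/SemivaluationShadows/Lines/birth.lean` of the crux
`stmt-ResolutionOfSingularities-16757` (`Theses.AbhyankarShadows.SemivaluationShadows`, the EXISTENCE
half of Teissier's semivaluation conjecture typed over finite sets), direction `⇐` of the standing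
Disproof's remark R2 ("rational rank one `⇔` arcs").

Data: a valuation ring `O ∋ k` of `K/k` of rational rank one (`Module.finrank ℤ (Additive Γˣ) = 1`),
a model `R ≤ R₁ ⊆ O` (`R₁` finitely generated, `Frac R₁ = K`), a formal ARC `α : R₁ →ₐ[k] k⟦X⟧`
CENTRED at the centre of `O` (`α y ∈ (X) ↔ ν y < 1`) and a scale `γ₀ ∈ Γ`, `0 < γ₀ < 1`, with
`γ₀ ^ ord α(y) ∈ ν(R₁)` whenever `α y ≠ 0` and `γ₀ ^ ord α(x) = ν x` for the non-zero `x` of the finite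
set `F ⊆ R`. Conclusion (`stub_arcShadow`, the `∃`-tail of the crux verbatim): a SHADOW of `(R, O)`
exact on `F`, namely

* `L := k⸨X⸩` (`LaurentSeries k`), `O' := k⟦X⟧` realised as the valuation ring of the `X`-adic
  valuation `Valued.v : k⸨X⸩ → ℤᵐ⁰`, `φ := (k⟦X⟧ → k⸨X⸩) ∘ α`;
* `ι : Γ_{O'} → Γ_O` the composite of the comparison `Γ_{O'} ≅ ℤᵐ⁰` (the abstract value group of
  the valuation SUBRING `O'` against `ℤᵐ⁰`: two equivalent valuations, both surjective —
  `exists_orderMonoidWithZeroHom_of_isEquiv`) with `ℤᵐ⁰ → Γ_O`, `exp (-n) ↦ γ₀ ^ n`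
  (`exists_zpow_orderMonoidWithZeroHom`; injective and ordered because `0 < γ₀ < 1`).

Checks: [rank] `Γ_{O'}ˣ ≅ ℤ` has `finrank 1`; [inside] power series have valuation `≤ 1`;
[centre] `v(f) < 1 ↔ f(0) = 0` (`valued_coe_powerSeries_lt_one_iff`); [rational'] landed
(`SemivaluationShadows.Negative.valuationSubring_laurentSeries_rational`); [fg] a submonoid of
elements `≤ 1` of a value group with cyclic units is finitely generated (landed
`ShadowsUniformize.Negative.submonoid_fg_of_isCyclic_units`); [values]/[exact]
`v(f) = exp (-ord f)` for `f ≠ 0` (`valued_coe_powerSeries`), so `ι (v (α y)) = γ₀ ^ ord α(y)`.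

No named facts are used; everything here is valuation-ring bookkeeping. [folklore]
-/

noncomputable section

-- single-problem summit: the doubled namespace component `ResolutionOfSingularities` is forced
set_option linter.dupNamespace false

open scoped WithZero

open Summit.ResolutionOfSingularities.ResolutionOfSingularities.Theorems.ShadowsUniformize.Negative
  (submonoid_fg_of_isCyclic_units)
open Summit.ResolutionOfSingularities.ResolutionOfSingularities.Theorems.SemivaluationShadows.Negative
  (valuationSubring_laurentSeries_rational)

namespace Summit.ResolutionOfSingularities.ResolutionOfSingularities.Theorems

/-! ## Two small constructions of ordered monoid-with-zero homomorphisms -/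

/-- **Comparison of the value groups of two equivalent valuations.** If `v₁ : L → Γ₁` is
surjective and equivalent to `v₂ : L → Γ₂`, there is an injective ordered monoid-with-zero
homomorphism `e : Γ₁ → Γ₂` with `e ∘ v₁ = v₂` (set `e (v₁ z) := v₂ z`; well defined and monotone by
the equivalence). [folklore] -/
theorem exists_orderMonoidWithZeroHom_of_isEquiv {L Γ₁ Γ₂ : Type*} [Ring L]
    [LinearOrderedCommGroupWithZero Γ₁] [LinearOrderedCommGroupWithZero Γ₂]
    (v₁ : Valuation L Γ₁) (v₂ : Valuation L Γ₂) (hs : Function.Surjective v₁)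
    (h : v₁.IsEquiv v₂) :
    ∃ e : Γ₁ →*₀o Γ₂, Function.Injective e ∧ ∀ z : L, e (v₁ z) = v₂ z := by
  have key : ∀ z : L, v₂ (Function.surjInv hs (v₁ z)) = v₂ z := fun z =>
    h.eq_iff.mp (Function.surjInv_eq hs (v₁ z))
  refine ⟨{ toFun := fun g => v₂ (Function.surjInv hs g)
            map_zero' := by
              have h0 := key 0
              rwa [map_zero, map_zero] at h0
            map_one' := by
              have h1 := key 1
              rwa [map_one, map_one] at h1
            map_mul' := fun a b => by
              obtain ⟨x, rfl⟩ := hs a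
              obtain ⟨y, rfl⟩ := hs b
              show v₂ (Function.surjInv hs (v₁ x * v₁ y)) =
                v₂ (Function.surjInv hs (v₁ x)) * v₂ (Function.surjInv hs (v₁ y))
              rw [key x, key y, ← map_mul v₁, key, map_mul]
            monotone' := fun a b hab => by
              obtain ⟨x, rfl⟩ := hs a
              obtain ⟨y, rfl⟩ := hs b
              show v₂ (Function.surjInv hs (v₁ x)) ≤ v₂ (Function.surjInv hs (v₁ y))
              rw [key x, key y]
              exact (h x y).mp hab }, ?_, ?_⟩
  · intro a b hab
    obtain ⟨x, rfl⟩ := hs a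
    obtain ⟨y, rfl⟩ := hs b
    change v₂ (Function.surjInv hs (v₁ x)) = v₂ (Function.surjInv hs (v₁ y)) at hab
    rw [key x, key y] at hab
    exact h.eq_iff.mpr hab
  · intro z
    exact key z

/-- **The scale homomorphism `exp (-n) ↦ γ₀ ^ n`.** For `0 < γ₀ < 1` in a linearly ordered
commutative group with zero `Γ`, there is an injective ordered monoid-with-zero homomorphism
`ι₀ : ℤᵐ⁰ → Γ` with `ι₀ (exp (-n)) = γ₀ ^ n` for all `n : ℤ` (and `ι₀ 0 = 0`): `n ↦ γ₀ ^ n` is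
strictly antitone. [folklore] -/
theorem exists_zpow_orderMonoidWithZeroHom {Γ : Type*} [LinearOrderedCommGroupWithZero Γ]
    (γ₀ : Γ) (h0 : 0 < γ₀) (h1 : γ₀ < 1) :
    ∃ ι₀ : ℤᵐ⁰ →*₀o Γ, Function.Injective ι₀ ∧ ∀ n : ℤ, ι₀ (WithZero.exp (-n)) = γ₀ ^ n := by
  have hne : γ₀ ≠ 0 := h0.ne'
  let f : Multiplicative ℤ →* Γ :=
    { toFun := fun m => γ₀ ^ (-(Multiplicative.toAdd m))
      map_one' := by simp
      map_mul' := fun a b => by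
        simp only [toAdd_mul, neg_add]
        rw [zpow_add₀ hne] }
  let g : ℤᵐ⁰ →*₀ Γ := WithZero.lift' f
  have hg : ∀ n : ℤ, g (WithZero.exp n) = γ₀ ^ (-n) := fun n => rfl
  have hg0 : ∀ a : ℤᵐ⁰, a ≠ 0 → g a = γ₀ ^ (-WithZero.log a) := by
    intro a ha
    conv_lhs => rw [← WithZero.exp_log ha]
    exact hg _
  have hmono : Monotone g := by
    intro a b hab
    by_cases ha : a = 0
    · rw [ha, map_zero]
      exact zero_le
    · have hb : b ≠ 0 := by
        rintro rfl
        exact ha (le_zero_iff.mp hab)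
      rw [hg0 a ha, hg0 b hb]
      rw [← WithZero.exp_log ha, ← WithZero.exp_log hb, WithZero.exp_le_exp] at hab
      exact zpow_le_zpow_right_of_le_one₀ h0 h1.le (neg_le_neg hab)
  refine ⟨{ g with monotone' := hmono }, ?_, ?_⟩
  · intro a b hab
    change g a = g b at hab
    by_cases ha : a = 0
    · subst ha
      by_contra hb
      rw [map_zero, hg0 b (fun h => hb h.symm)] at hab
      exact zpow_ne_zero _ hne hab.symm
    · by_cases hb : b = 0
      · rw [hb, map_zero, hg0 a ha] at hab
        exact absurd hab (zpow_ne_zero _ hne)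
      · rw [hg0 a ha, hg0 b hb] at hab
        have hlog : WithZero.log a = WithZero.log b :=
          neg_injective (zpow_right_injective₀ h0 h1.ne hab)
        rw [← WithZero.exp_log ha, ← WithZero.exp_log hb, hlog]
  · intro n
    change g (WithZero.exp (-n)) = γ₀ ^ n
    rw [hg, neg_neg]

/-! ## The `X`-adic valuation of a power series inside `k⸨X⸩` -/

section Laurent

variable (k : Type) [Field k]

/-- Power series have `X`-adic valuation `≤ 1`. [folklore] -/
theorem valued_coe_powerSeries_le_one (f : PowerSeries k) :
    Valued.v (f : LaurentSeries k) ≤ 1 := by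
  rw [LaurentSeries.valuation_def, ← LaurentSeries.coe_algebraMap]
  exact (PowerSeries.idealX k).valuation_le_one f

/-- A power series has `X`-adic valuation `< 1` iff its constant coefficient vanishes. [folklore] -/
theorem valued_coe_powerSeries_lt_one_iff (f : PowerSeries k) :
    Valued.v (f : LaurentSeries k) < 1 ↔ PowerSeries.constantCoeff f = 0 := by
  rw [LaurentSeries.valuation_def, ← LaurentSeries.coe_algebraMap,
    IsDedekindDomain.HeightOneSpectrum.valuation_lt_one_iff_mem]
  change f ∈ Ideal.span {PowerSeries.X} ↔ _
  rw [Ideal.mem_span_singleton, PowerSeries.X_dvd_iff]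

/-- **The `X`-adic valuation of a non-zero power series is `exp (-ord f)`**: write
`f = X ^ ord f * g` with `g(0) ≠ 0`, a unit of `k⟦X⟧`. [folklore] -/
theorem valued_coe_powerSeries (f : PowerSeries k) (hf : f ≠ 0) :
    Valued.v (f : LaurentSeries k) = WithZero.exp (-(f.order.toNat : ℤ)) := by
  have hg : PowerSeries.divXPowOrder f ∉ (PowerSeries.idealX k).asIdeal := by
    change PowerSeries.divXPowOrder f ∉ Ideal.span {PowerSeries.X}
    rw [Ideal.mem_span_singleton, PowerSeries.X_dvd_iff,
      PowerSeries.constantCoeff_divXPowOrder_eq_zero_iff]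
    exact hf
  have h1 : Valued.v ((PowerSeries.divXPowOrder f : PowerSeries k) : LaurentSeries k) = 1 := by
    rw [LaurentSeries.valuation_def, ← LaurentSeries.coe_algebraMap]
    exact (PowerSeries.idealX k).valuation_eq_one_iff_notMem.mpr hg
  conv_lhs => rw [← PowerSeries.X_pow_order_mul_divXPowOrder (f := f)]
  rw [PowerSeries.coe_mul, map_mul, h1, mul_one, PowerSeries.coe_pow]
  exact LaurentSeries.valuation_X_pow k _

end Laurent

/-! ## The arc transfer, binder form -/

/-- **The rank-one arc transfer** (binder form of the registered `Sig.stub_arcShadow`; conclusion =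
the crux's `HasShadow O R F` unfolded verbatim). Given a valuation ring `O ∋ k` of `K` of rational
rank one, a model `R ≤ R₁ ⊆ O` (`R₁` finitely generated, `Frac R₁ = K`), an arc
`α : R₁ →ₐ[k] k⟦X⟧` centred at the centre of `O`, and a scale `0 < γ₀ < 1` with
`γ₀ ^ ord α(y) ∈ ν(R₁)` (`α y ≠ 0`) and `γ₀ ^ ord α(x) = ν(x)` for the non-zero `x ∈ F`, the datum
`L = k⸨X⸩`, `O' = k⟦X⟧`, `φ = (k⟦X⟧ ↪ k⸨X⸩) ∘ α`, `ι (exp (-n)) = γ₀ ^ n` is a shadow of `(R, O)`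
exact on `F` (module docstring). [folklore] -/
theorem arcShadow (k K : Type) [Field k] [Field K] [Algebra k K] (O : ValuationSubring K)
    (hk : ∀ c : k, algebraMap k K c ∈ O)
    (hrat : ∀ x : K, x ∈ O → ∃ c : k, O.valuation (x - algebraMap k K c) < 1)
    (hrr : Module.finrank ℤ (Additive (O.ValueGroup)ˣ) = 1)
    (R R₁ : Subalgebra k K) (hle : R ≤ R₁) (h₁O : R₁.toSubring ≤ O.toSubring) (hfg₁ : R₁.FG)
    (hfrac : IsFractionRing R₁ K) (α : R₁ →ₐ[k] PowerSeries k) (γ₀ : O.ValueGroup)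
    (hγ₀ : 0 < γ₀) (hγ₁ : γ₀ < 1)
    (hcen : ∀ y : R₁, PowerSeries.constantCoeff (α y) = 0 ↔ O.valuation (y : K) < 1)
    (h6b : ∀ y : R₁, α y ≠ 0 → ∃ y' : R₁, γ₀ ^ (α y).order.toNat = O.valuation (y' : K))
    (F : Finset R)
    (hex : ∀ x ∈ F, ((x : R) : K) ≠ 0 → α (Subalgebra.inclusion hle x) ≠ 0 ∧
        γ₀ ^ (α (Subalgebra.inclusion hle x)).order.toNat = O.valuation ((x : R) : K)) :
    ∃ (R₁ : Subalgebra k K) (hle : R ≤ R₁) (_ : R₁.toSubring ≤ O.toSubring), R₁.FG ∧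
    IsFractionRing R₁ K ∧ ∃ (L : Type) (_ : Field L) (_ : Algebra k L) (φ : R₁ →ₐ[k] L)
    (O' : ValuationSubring L), Module.finrank ℤ (Additive (O'.ValueGroup)ˣ) =
      Module.finrank ℤ (Additive (O.ValueGroup)ˣ) ∧ (∀ y : R₁, φ y ∈ O') ∧
    (∀ y : R₁, O'.valuation (φ y) < 1 ↔ O.valuation (y : K) < 1) ∧
    (∀ z : L, z ∈ O' → ∃ c : k, O'.valuation (z - algebraMap k L c) < 1) ∧
    (MonoidHom.mrange (O'.valuation.toMonoidWithZeroHom.toMonoidHom.comp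
      φ.toRingHom.toMonoidHom)).FG ∧
    ∃ ι : O'.ValueGroup →*₀o O.ValueGroup, Function.Injective ι ∧
      (∀ y : R₁, φ y ≠ 0 → ∃ y' : R₁, ι (O'.valuation (φ y)) = O.valuation (y' : K)) ∧
      ∀ x ∈ F, ι (O'.valuation (φ (Subalgebra.inclusion hle x))) = O.valuation ((x : R) : K) := by
  classical
  -- `hk` and `hrat` are part of the registered signature (the crux's standing hypotheses on `O`);
  -- the transfer itself does not need them.
  have _hk := hk
  have _hrat := hrat
  -- the Laurent side: `L = k⸨X⸩`, `O' = k⟦X⟧` as the `X`-adic valuation ring, `φ = coe ∘ α`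
  set O' : ValuationSubring (LaurentSeries k) :=
    (Valued.v (R := LaurentSeries k)).valuationSubring with hO'
  have hIE : (Valued.v (R := LaurentSeries k)).IsEquiv O'.valuation :=
    Valuation.isEquiv_valuation_valuationSubring _
  let φ : R₁ →ₐ[k] LaurentSeries k :=
    { (algebraMap (PowerSeries k) (LaurentSeries k)).comp α.toRingHom with
      commutes' := fun c => by
        show algebraMap (PowerSeries k) (LaurentSeries k) (α (algebraMap k R₁ c)) =
          algebraMap k (LaurentSeries k) c
        rw [α.commutes]
        rfl }
  have hφ : ∀ y : R₁, φ y = ((α y : PowerSeries k) : LaurentSeries k) := fun y => rfl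
  have hin : ∀ y : R₁, φ y ∈ O' := fun y => by
    rw [hφ, hO', Valuation.mem_valuationSubring_iff]
    exact valued_coe_powerSeries_le_one k (α y)
  -- the comparison `e : Γ_{O'} ≅ ℤᵐ⁰` and the scale `ι₀ : ℤᵐ⁰ → Γ_O`
  obtain ⟨e, he_inj, he⟩ := exists_orderMonoidWithZeroHom_of_isEquiv O'.valuation
    (Valued.v (R := LaurentSeries k)) O'.valuation_surjective hIE.symm
  have he_surj : Function.Surjective e := fun x => by
    obtain ⟨z, hz⟩ := LaurentSeries.valuation_surjective k x
    exact ⟨O'.valuation z, by rw [he, hz]⟩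
  obtain ⟨ι₀, hι₀_inj, hι₀⟩ := exists_zpow_orderMonoidWithZeroHom γ₀ hγ₀ hγ₁
  have hkey : ∀ f : PowerSeries k, f ≠ 0 →
      ι₀ (e (O'.valuation (f : LaurentSeries k))) = γ₀ ^ f.order.toNat := by
    intro f hf
    rw [he, valued_coe_powerSeries k f hf, hι₀, zpow_natCast]
  -- the value group of `O'` is `ℤ`
  let eM : O'.ValueGroup ≃* ℤᵐ⁰ := MulEquiv.ofBijective e ⟨he_inj, he_surj⟩
  let eZ : (O'.ValueGroup)ˣ ≃* Multiplicative ℤ :=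
    (Units.mapEquiv eM).trans WithZero.unitsWithZeroEquiv
  have hrank : Module.finrank ℤ (Additive (O'.ValueGroup)ˣ) = 1 := by
    rw [(MulEquiv.toAdditiveLeft eZ).toIntLinearEquiv.finrank_eq, Module.finrank_self]
  haveI hcyc : IsCyclic (O'.ValueGroup)ˣ := isCyclic_of_surjective eZ.symm eZ.symm.surjective
  refine ⟨R₁, hle, h₁O, hfg₁, hfrac, LaurentSeries k, inferInstance, inferInstance, φ, O', ?_, hin,
    ?_, ?_, ?_, ι₀.comp e, hι₀_inj.comp he_inj, ?_, ?_⟩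
  · -- [rank]
    rw [hrr, hrank]
  · -- [centre]
    intro y
    rw [← hcen y, ← hIE.lt_one_iff_lt_one, hφ]
    exact valued_coe_powerSeries_lt_one_iff k (α y)
  · -- [rational']
    rw [hO']
    exact valuationSubring_laurentSeries_rational k
  · -- [fg]
    refine submonoid_fg_of_isCyclic_units _ ?_
    rintro x ⟨y, rfl⟩
    exact (O'.valuation_le_one_iff _).mpr (hin y)
  · -- [values]
    intro y hy
    have hα : α y ≠ 0 := fun h0 => hy (by rw [hφ, h0, PowerSeries.coe_zero])
    obtain ⟨y', hy'⟩ := h6b y hα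
    refine ⟨y', ?_⟩
    rw [← hy', OrderMonoidWithZeroHom.comp_apply, hφ]
    exact hkey _ hα
  · -- [exact]
    intro x hx
    by_cases hx0 : ((x : R) : K) = 0
    · have hx0' : x = 0 := by exact_mod_cast hx0
      subst hx0'
      simp
    · obtain ⟨hα, hv⟩ := hex x hx hx0
      rw [← hv, OrderMonoidWithZeroHom.comp_apply, hφ]
      exact hkey _ hα

/-! ## The registered stub signature, by name

`HasShadow` and `Sig.stub_arcShadow` below are VERBATIM copies of the line skeleton
`Cruxes/SemivaluationShadows/Lines/birth.lean` (v2); they are `private` so that sibling stub files can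
do the same without name clashes — the registered statement unfolds definitionally to `arcShadow`'s. -/

/-- VERBATIM copy of the skeleton's `HasShadow O R F`: the conclusion of the crux
`SemivaluationShadows` for one datum — a finite set `F` of a finitely generated `k`-subalgebra `R` of
`K` inside the valuation ring `O` admits a shadow exact on `F` (the `∃`-tail of the route statement;
ref: Teissier 2023, p. 5, Conjecture). -/
private def HasShadow {k K : Type} [Field k] [Field K] [Algebra k K] (O : ValuationSubring K)
    (R : Subalgebra k K) (F : Finset R) : Prop :=
  ∃ (R₁ : Subalgebra k K) (hle : R ≤ R₁) (_ : R₁.toSubring ≤ O.toSubring), R₁.FG ∧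
    IsFractionRing R₁ K ∧ ∃ (L : Type) (_ : Field L) (_ : Algebra k L) (φ : R₁ →ₐ[k] L)
    (O' : ValuationSubring L), Module.finrank ℤ (Additive (O'.ValueGroup)ˣ) =
      Module.finrank ℤ (Additive (O.ValueGroup)ˣ) ∧ (∀ y : R₁, φ y ∈ O') ∧
    (∀ y : R₁, O'.valuation (φ y) < 1 ↔ O.valuation (y : K) < 1) ∧
    (∀ z : L, z ∈ O' → ∃ c : k, O'.valuation (z - algebraMap k L c) < 1) ∧
    (MonoidHom.mrange (O'.valuation.toMonoidWithZeroHom.toMonoidHom.comp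
      φ.toRingHom.toMonoidHom)).FG ∧
    ∃ ι : O'.ValueGroup →*₀o O.ValueGroup, Function.Injective ι ∧
      (∀ y : R₁, φ y ≠ 0 → ∃ y' : R₁, ι (O'.valuation (φ y)) = O.valuation (y' : K)) ∧
      ∀ x ∈ F, ι (O'.valuation (φ (Subalgebra.inclusion hle x))) = O.valuation ((x : R) : K)

/-- VERBATIM copy of the skeleton's registered statement `Sig.stub_arcShadow` (the rank-one ARC
TRANSFER): a rational valuation ring `O ∋ k` of `K` of rational rank one, a model `R ≤ R₁ ⊆ O`, an
arc `α : R₁ →ₐ[k] k⟦t⟧` centred at the centre of `O` and a scale `0 < γ₀ < 1` with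
`γ₀ ^ ord α(y) ∈ ν(R₁)` (`α y ≠ 0`) and `γ₀ ^ ord α(x) = ν x` on the non-zero `x ∈ F` give
`HasShadow O R F`. -/
private def Sig.stub_arcShadow : Prop :=
  ∀ (k K : Type) [Field k] [Field K] [Algebra k K] (O : ValuationSubring K),
    (∀ c : k, algebraMap k K c ∈ O) →
    (∀ x : K, x ∈ O → ∃ c : k, O.valuation (x - algebraMap k K c) < 1) →
    Module.finrank ℤ (Additive (O.ValueGroup)ˣ) = 1 →
    ∀ (R R₁ : Subalgebra k K) (hle : R ≤ R₁), R₁.toSubring ≤ O.toSubring → R₁.FG →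
    IsFractionRing R₁ K → ∀ (α : R₁ →ₐ[k] PowerSeries k) (γ₀ : O.ValueGroup), 0 < γ₀ → γ₀ < 1 →
    (∀ y : R₁, PowerSeries.constantCoeff (α y) = 0 ↔ O.valuation (y : K) < 1) →
    (∀ y : R₁, α y ≠ 0 → ∃ y' : R₁, γ₀ ^ (α y).order.toNat = O.valuation (y' : K)) →
    ∀ F : Finset R,
    (∀ x ∈ F, ((x : R) : K) ≠ 0 → α (Subalgebra.inclusion hle x) ≠ 0 ∧
        γ₀ ^ (α (Subalgebra.inclusion hle x)).order.toNat = O.valuation ((x : R) : K)) →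
    HasShadow O R F

/-- **Stub `stub_arcShadow` of line `birth` for the crux `SemivaluationShadows`** (registered signature
`Sig.stub_arcShadow`, by name; it unfolds to the skeleton's statement verbatim and is `arcShadow`
definitionally). [folklore] -/
theorem stub_arcShadow : Sig.stub_arcShadow :=
  arcShadow

end Summit.ResolutionOfSingularities.ResolutionOfSingularities.Theorems

end
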